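import Mathlib.RingTheory.SimpleModule.WedderburnArtin
import Mathlib.RingTheory.LittleWedderburn
import Mathlib.RingTheory.SimpleRing.Matrix
import Mathlib.RingTheory.Artinian.Module
import Mathlib.Data.Matrix.Basis
import Mathlib.LinearAlgebra.Dimension.Constructions
import Mathlib.LinearAlgebra.FiniteDimensional.Lemmas
import HarnessLib

/-!
# Forms of a matrix algebra over a finite field are split

Let `k₀ ⊆ k` be fields with `k₀` finite and `S ⊆ M_n(k)` (`n ≥ 1`) a `k₀`-subalgebra which is
a **`k₀`-form** of `M_n(k)`: `S` has a `k₀`-basis which is also a `k`-basis `b` of `M_n(k)`, and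
`S` consists exactly of the matrices whose `b`-coordinates lie in `k₀`.  Then `S ≅ M_n(k₀)` as
`k₀`-algebras (`nonempty_algEquiv_matrix_of_isForm`).  Proof, as in Deligne–Serre's proof of
their Lemme 6.13 ("la `k'`-algèbre engendrée … provient d'une algèbre centrale simple sur `k`.
Or le groupe de Brauer d'un corps fini est trivial, comme Wedderburn l'a démontré"): `S` is a
simple ring (the `k`-span of a non-zero two-sided ideal of `S` is a non-zero two-sided ideal of
`M_n(k)`, hence everything, so the ideal has full `k₀`-dimension); by Wedderburn–Artin
(`IsSimpleRing.exists_algEquiv_matrix_divisionRing_finite`) `S ≅ M_m(D)` with `D` a finite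
division algebra, commutative by Wedderburn's little theorem (`littleWedderburn`); the scalars
`d ∈ D` give central elements of `S`, which are scalar matrices in `M_n(k)` (they commute with the
spanning set `b`, `Matrix.mem_range_scalar_of_commute_single`) with scalar in `k₀` (coordinates),
so `D = k₀`, and `m = n` by dimension count.

Also here, for reuse: the subalgebra of an algebra cut out by "coordinates in a subring"
(`exists_subalgebra_basis_of_repr_mem_range`): if a `K`-basis `b` of a `K`-algebra `R` consists
of elements of a multiplicative family `M : G →* R` all of whose members have `b`-coordinates in
the image of `K₀ → K`, then the elements of `R` with coordinates in `K₀` form a `K₀`-subalgebra,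
free over `K₀` on `b`.  (This is the shape in which forms arise from trace conditions:
Carayol–Serre, Mazur's *Deformation theory* §6, where it is applied both over the coefficient
rings `A₀ ⊆ A` and over their residue fields.)  NOT here: central simple algebras and Brauer
groups in general (`Literature.RingTheory.CentralSimple`), Skolem–Noether.

## References

* P. Deligne, J.-P. Serre, *Formes modulaires de poids 1*, Ann. Sci. ÉNS (4) 7 (1974), proof of
  Lemme 6.13.
* B. Mazur, *An introduction to the deformation theory of Galois representations*, in Modular
  Forms and Fermat's Last Theorem (Springer 1997), §6.
* C. W. Curtis, I. Reiner, *Representation theory of finite groups and associative algebras*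
  (1962), (68.1) and §70 (Schur index over finite fields).
-/

noncomputable section

open Module Matrix

namespace Literature.RepresentationTheory.Semisimple

universe u v

/-! ### The subalgebra cut out by coordinates in a subring -/

section CoordSubalgebra

variable {K₀ : Type*} [CommRing K₀] {K : Type*} [CommRing K] [Algebra K₀ K]
  {R : Type*} [Ring R] [Algebra K R] [Algebra K₀ R] [IsScalarTower K₀ K R]
  {ι : Type*} [Fintype ι] {G : Type*} [Monoid G]

/-- **The subalgebra of elements with coordinates in a subring.**  Let `K₀ → K` be injective,
`R` a `K`-algebra with `K`-basis `b`, and `M : G →* R` a multiplicative family such that every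
`b i` is some `M (a i)` and every `M g` has all its `b`-coordinates in (the image of) `K₀`.  Then
`S = {x ∈ R | all b-coordinates of x lie in K₀}` is a `K₀`-subalgebra of `R`, with a `K₀`-basis
`bS` given by the `b i`, and the `b`-coordinates of `y ∈ S` are its `bS`-coordinates.  (The
linear-algebra half of the Carayol–Serre argument, Mazur §6.) [folklore] -/
theorem exists_subalgebra_basis_of_repr_mem_range (hinj : Function.Injective (algebraMap K₀ K))
    (b : Basis ι K R) (M : G →* R) (a : ι → G) (hb : ∀ i, b i = M (a i))
    (hcoord : ∀ g i, b.repr (M g) i ∈ (algebraMap K₀ K).range) :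
    ∃ (S : Subalgebra K₀ R) (bS : Basis ι K₀ S),
      (∀ x, x ∈ S ↔ ∀ i, b.repr x i ∈ (algebraMap K₀ K).range) ∧
      (∀ i, (bS i : R) = b i) ∧
      (∀ (y : S) i, b.repr (y : R) i = algebraMap K₀ K (bS.repr y i)) := by
  classical
  set rg := (algebraMap K₀ K).range with hrg
  have hsmul : ∀ (c : K) (x : R), c ∈ rg → (∀ i, b.repr x i ∈ rg) →
      ∀ i, b.repr (c • x) i ∈ rg := fun c x hc hx i => by
    rw [map_smul, Finsupp.smul_apply, smul_eq_mul]; exact mul_mem hc (hx i)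
  have hmul : ∀ x y : R, (∀ i, b.repr x i ∈ rg) → (∀ i, b.repr y i ∈ rg) →
      ∀ i, b.repr (x * y) i ∈ rg := by
    intro x y hx hy i
    rw [← b.sum_repr x, ← b.sum_repr y, Finset.sum_mul, map_sum, Finsupp.finsetSum_apply]
    refine sum_mem fun j _ => ?_
    rw [Finset.mul_sum, map_sum, Finsupp.finsetSum_apply]
    refine sum_mem fun l _ => ?_
    rw [smul_mul_assoc, mul_smul_comm, hb j, hb l, ← map_mul, map_smul, map_smul,
      Finsupp.smul_apply, Finsupp.smul_apply, smul_eq_mul, smul_eq_mul]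
    exact mul_mem (hx j) (mul_mem (hy l) (hcoord _ i))
  have hone : ∀ i, b.repr (1 : R) i ∈ rg := fun i => by rw [← map_one M]; exact hcoord 1 i
  let S : Subalgebra K₀ R :=
    { carrier := {x | ∀ i, b.repr x i ∈ rg}
      mul_mem' := fun {x y} hx hy => hmul x y hx hy
      one_mem' := hone
      add_mem' := fun {x y} hx hy i => by
        rw [map_add, Finsupp.add_apply]; exact add_mem (hx i) (hy i)
      zero_mem' := fun i => by rw [map_zero, Finsupp.zero_apply]; exact zero_mem _
      algebraMap_mem' := fun c => by
        intro i
        rw [IsScalarTower.algebraMap_apply K₀ K R, Algebra.algebraMap_eq_smul_one]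
        exact hsmul _ _ ⟨c, rfl⟩ hone i }
  have hmemS : ∀ x, x ∈ S ↔ ∀ i, b.repr x i ∈ rg := fun x => Iff.rfl
  -- the basis of `S`
  have hbmem : ∀ i, b i ∈ S := fun i => by
    rw [hmemS]
    intro i'
    rw [b.repr_self, Finsupp.single_apply]
    split_ifs
    · exact one_mem _
    · exact zero_mem _
  let v : ι → S := fun i => ⟨b i, hbmem i⟩
  have hvli : LinearIndependent K₀ v := by
    apply LinearIndependent.of_comp S.val.toLinearMap
    have hcomp : (S.val.toLinearMap : S → R) ∘ v = b := rfl
    rw [hcomp]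
    refine b.linearIndependent.restrict_scalars fun r s h => hinj ?_
    simpa only [Algebra.smul_def, mul_one] using h
  have hcoe_sum : ∀ c : ι → K₀, ((∑ i, c i • v i : S) : R) = ∑ i, algebraMap K₀ K (c i) • b i := by
    intro c
    change S.val (∑ i, c i • v i) = _
    rw [map_sum]
    refine Finset.sum_congr rfl fun i _ => ?_
    rw [map_smul, algebra_compatible_smul K (c i)]
    rfl
  have hvsp : ⊤ ≤ Submodule.span K₀ (Set.range v) := by
    rintro y -
    have hy := (hmemS y).mp y.2
    choose c hc using hy
    have hyc : y = ∑ i, c i • v i := by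
      apply Subtype.ext
      rw [hcoe_sum]
      conv_lhs => rw [← b.sum_repr (y : R)]
      exact Finset.sum_congr rfl fun i _ => by rw [hc i]
    rw [hyc]
    exact Submodule.sum_mem _ fun i _ => Submodule.smul_mem _ _ (Submodule.subset_span ⟨i, rfl⟩)
  let bS : Basis ι K₀ S := Basis.mk hvli hvsp
  have hbS : ⇑bS = v := Basis.coe_mk _ _
  refine ⟨S, bS, hmemS, fun i => by rw [hbS], fun y i => ?_⟩
  have hy : (y : R) = ∑ j, algebraMap K₀ K (bS.repr y j) • b j := by
    rw [← hcoe_sum fun j => bS.repr y j, ← hbS, bS.sum_repr y]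
  rw [hy, b.repr_sum_self]

end CoordSubalgebra

/-! ### A `k₀`-form of `M_n(k)` is `M_n(k₀)` when `k₀` is finite -/

section FiniteField

variable {k₀ : Type u} [Field k₀] [Finite k₀] {k : Type v} [Field k] [Algebra k₀ k]
  {n : ℕ} {ι : Type*} [Fintype ι]

/-- **A `k₀`-form of `M_n(k)` over a finite field `k₀` is split.**  Let `k₀ → k` be a field
extension with `k₀` finite, `n ≥ 1`, `b` a `k`-basis of `M_n(k)` and `S ⊆ M_n(k)` a
`k₀`-subalgebra with a `k₀`-basis `bS` consisting of the `b i`, such that every element of `S`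
has its `b`-coordinates in `k₀`.  Then `S ≃ₐ[k₀] M_n(k₀)`.  (`S` is simple; Wedderburn–Artin and
Wedderburn's little theorem give `S ≅ M_m(D)` with `D` a finite field; `D` is central in `S`,
the centre of `S` consists of scalar matrices with scalar in `k₀`, so `D = k₀` and `m = n`.)
Deligne–Serre, proof of Lemme 6.13; Curtis–Reiner (68.1). [folklore] -/
theorem nonempty_algEquiv_matrix_of_isForm (hn : 0 < n)
    (b : Basis ι k (Matrix (Fin n) (Fin n) k)) (S : Subalgebra k₀ (Matrix (Fin n) (Fin n) k))
    (bS : Basis ι k₀ S) (hbS : ∀ i, (bS i : Matrix (Fin n) (Fin n) k) = b i)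
    (hmem : ∀ x, x ∈ S → ∀ i, b.repr x i ∈ (algebraMap k₀ k).range) :
    Nonempty (S ≃ₐ[k₀] Matrix (Fin n) (Fin n) k₀) := by
  classical
  haveI : NeZero n := ⟨hn.ne'⟩
  haveI : Module.Finite k₀ S := Module.Finite.of_basis bS
  haveI : FaithfulSMul k₀ k :=
    (faithfulSMul_iff_algebraMap_injective k₀ k).mpr (algebraMap k₀ k).injective
  have hfinS : finrank k₀ S = Fintype.card ι := finrank_eq_card_basis bS
  have hcardι : Fintype.card ι = n * n := by
    have h := finrank_eq_card_basis b
    rw [Module.finrank_matrix, Module.finrank_self, Fintype.card_fin, mul_one] at h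
    exact h.symm
  have hspan : Submodule.span k (Set.range b) = ⊤ := b.span_eq
  -- ### `S` is a simple ring
  have hspanI : ∀ I : TwoSidedIdeal S, I ≠ ⊥ →
      Submodule.span k ((fun i : S => (i : Matrix (Fin n) (Fin n) k)) '' (I : Set S)) = ⊤ := by
    intro I hI
    set T := Submodule.span k ((fun i : S => (i : Matrix (Fin n) (Fin n) k)) '' (I : Set S))
      with hTdef
    have hleft : ∀ x y : Matrix (Fin n) (Fin n) k, y ∈ T → x * y ∈ T := by
      intro x y hy
      induction hy using Submodule.span_induction with
      | mem y hy =>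
        obtain ⟨i, hi, rfl⟩ := hy
        have hx : x ∈ Submodule.span k (Set.range b) := by rw [hspan]; exact Submodule.mem_top
        induction hx using Submodule.span_induction with
        | mem x hx =>
          obtain ⟨j, rfl⟩ := hx
          refine Submodule.subset_span ⟨bS j * i, I.mul_mem_left _ _ hi, ?_⟩
          change ((bS j : Matrix (Fin n) (Fin n) k)) * i = b j * i
          rw [hbS]
        | zero => rw [zero_mul]; exact Submodule.zero_mem _
        | add x x' _ _ hx hx' => rw [add_mul]; exact Submodule.add_mem _ hx hx'
        | smul c x _ hx => rw [smul_mul_assoc]; exact Submodule.smul_mem _ _ hx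
      | zero => rw [mul_zero]; exact Submodule.zero_mem _
      | add y y' _ _ hy hy' => rw [mul_add]; exact Submodule.add_mem _ hy hy'
      | smul c y _ hy => rw [mul_smul_comm]; exact Submodule.smul_mem _ _ hy
    have hright : ∀ x y : Matrix (Fin n) (Fin n) k, x ∈ T → x * y ∈ T := by
      intro x y hx
      induction hx using Submodule.span_induction with
      | mem x hx =>
        obtain ⟨i, hi, rfl⟩ := hx
        have hy : y ∈ Submodule.span k (Set.range b) := by rw [hspan]; exact Submodule.mem_top
        induction hy using Submodule.span_induction with
        | mem y hy =>
          obtain ⟨j, rfl⟩ := hy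
          refine Submodule.subset_span ⟨i * bS j, I.mul_mem_right _ _ hi, ?_⟩
          change (i : Matrix (Fin n) (Fin n) k) * (bS j : Matrix (Fin n) (Fin n) k) = i * b j
          rw [hbS]
        | zero => rw [mul_zero]; exact Submodule.zero_mem _
        | add y y' _ _ hy hy' => rw [mul_add]; exact Submodule.add_mem _ hy hy'
        | smul c y _ hy => rw [mul_smul_comm]; exact Submodule.smul_mem _ _ hy
      | zero => rw [zero_mul]; exact Submodule.zero_mem _
      | add x x' _ _ hx hx' => rw [add_mul]; exact Submodule.add_mem _ hx hx'
      | smul c x _ hx => rw [smul_mul_assoc]; exact Submodule.smul_mem _ _ hx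
    let J : TwoSidedIdeal (Matrix (Fin n) (Fin n) k) :=
      TwoSidedIdeal.mk' (T : Set (Matrix (Fin n) (Fin n) k)) (Submodule.zero_mem _)
        (fun hx hy => Submodule.add_mem _ hx hy) (fun hx => Submodule.neg_mem _ hx)
        (fun {x y} hy => hleft x y hy) (fun {x y} hx => hright x y hx)
    have hJmem : ∀ x, x ∈ J ↔ x ∈ T := fun x => by
      simp only [J, TwoSidedIdeal.mem_mk', SetLike.mem_coe]
    have hJ : J ≠ ⊥ := by
      intro h
      apply hI
      rw [eq_bot_iff]
      intro i hi
      have : (i : Matrix (Fin n) (Fin n) k) ∈ J :=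
        (hJmem _).mpr (Submodule.subset_span ⟨i, hi, rfl⟩)
      rw [h, TwoSidedIdeal.mem_bot] at this
      rw [TwoSidedIdeal.mem_bot]
      exact Subtype.ext this
    have hJtop : J = ⊤ := (eq_bot_or_eq_top J).resolve_left hJ
    rw [eq_top_iff]
    rintro x -
    rw [← hJmem, hJtop]; trivial
  haveI hSsimple : IsSimpleRing S := by
    haveI : Nontrivial (TwoSidedIdeal S) := ⟨⟨⊥, ⊤, fun h => by
      have : (1 : S) ∈ (⊥ : TwoSidedIdeal S) := by rw [h]; trivial
      rw [TwoSidedIdeal.mem_bot] at this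
      exact one_ne_zero this⟩⟩
    refine ⟨⟨fun I => ?_⟩⟩
    by_cases hI : I = ⊥
    · exact Or.inl hI
    right
    have hT := hspanI I hI
    obtain ⟨κ', a', -, hspan', hli'⟩ :=
      exists_linearIndependent' k (fun i : (I : Set S) => ((i : S) : Matrix (Fin n) (Fin n) k))
    rw [← Set.image_eq_range] at hspan'
    rw [hT] at hspan'
    haveI : Finite κ' := hli'.finite
    letI : Fintype κ' := Fintype.ofFinite κ'
    let b' : Basis κ' k (Matrix (Fin n) (Fin n) k) := Basis.mk hli' (by rw [hspan'])
    have hcard' : Fintype.card κ' = Fintype.card ι := by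
      rw [← finrank_eq_card_basis b', finrank_eq_card_basis b]
    let Ik : Submodule k₀ S :=
      { carrier := I
        add_mem' := fun hx hy => I.add_mem hx hy
        zero_mem' := I.zero_mem
        smul_mem' := fun c x hx => by
          rw [Algebra.smul_def]; exact I.mul_mem_left _ _ hx }
    let v' : κ' → Ik := fun t => ⟨(a' t : S), (a' t).2⟩
    have hv'li : LinearIndependent k₀ v' := by
      apply LinearIndependent.of_comp (S.val.toLinearMap ∘ₗ Ik.subtype)
      have : ((S.val.toLinearMap ∘ₗ Ik.subtype : Ik →ₗ[k₀] Matrix (Fin n) (Fin n) k) ∘ v') =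
          (fun i : (I : Set S) => ((i : S) : Matrix (Fin n) (Fin n) k)) ∘ a' := rfl
      rw [this]
      exact hli'.restrict_scalars' k₀
    have hIk : Ik = ⊤ := by
      apply Submodule.eq_top_of_finrank_eq
      apply le_antisymm (Submodule.finrank_le Ik)
      rw [hfinS, ← hcard']
      exact hv'li.fintype_card_le_finrank
    have h1 : (1 : S) ∈ I := by
      change (1 : S) ∈ Ik
      rw [hIk]; exact Submodule.mem_top
    exact (TwoSidedIdeal.one_mem_iff I).mp h1
  -- ### Wedderburn–Artin and Wedderburn's little theorem
  haveI : IsArtinianRing S := IsArtinianRing.of_finite k₀ S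
  obtain ⟨m, hm, D, _, _, _, ⟨e⟩⟩ := IsSimpleRing.exists_algEquiv_matrix_divisionRing_finite k₀ S
  haveI : Finite D := Module.finite_of_finite k₀
  have hDcomm : ∀ x y : D, x * y = y * x := fun x y => (littleWedderburn D).mul_comm x y
  -- ### every `d ∈ D` is a scalar from `k₀`: the centre of `S` is `k₀`
  -- a non-zero coordinate of `1`
  obtain ⟨i₀, hi₀⟩ : ∃ i₀, b.repr (1 : Matrix (Fin n) (Fin n) k) i₀ ≠ 0 := by
    by_contra h
    push Not at h
    have h1 : (1 : Matrix (Fin n) (Fin n) k) = 0 := b.ext_elem_iff.mpr fun i => by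
      rw [h i, map_zero, Finsupp.zero_apply]
    exact one_ne_zero h1
  have hsurj : Function.Surjective (algebraMap k₀ D) := by
    intro d
    let zd : Matrix (Fin m) (Fin m) D := Matrix.diagonal fun _ => d
    have hzd : ∀ w : Matrix (Fin m) (Fin m) D, w * zd = zd * w := fun w => by
      ext a c
      simp only [zd, Matrix.mul_diagonal, Matrix.diagonal_mul, hDcomm]
    set y : S := e.symm zd with hydef
    have hy : ∀ w : S, w * y = y * w := fun w => e.injective (by
      rw [map_mul, map_mul, hydef, e.apply_symm_apply, hzd])
    -- `y` commutes with every matrix, hence is a scalar matrix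
    have hycomm : ∀ x : Matrix (Fin n) (Fin n) k, Commute x (y : Matrix (Fin n) (Fin n) k) := by
      intro x
      have hx : x ∈ Submodule.span k (Set.range b) := by rw [hspan]; exact Submodule.mem_top
      induction hx using Submodule.span_induction with
      | mem x hx =>
        obtain ⟨j, rfl⟩ := hx
        have := congrArg Subtype.val (hy (bS j))
        rw [Subalgebra.coe_mul, Subalgebra.coe_mul, hbS] at this
        exact this
      | zero => exact Commute.zero_left _
      | add x x' _ _ hx hx' => exact hx.add_left hx'
      | smul c x _ hx => exact hx.smul_left c
    obtain ⟨r, hr⟩ := Matrix.mem_range_scalar_of_commute_single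
      (M := (y : Matrix (Fin n) (Fin n) k)) fun a c _ => hycomm _
    -- the scalar `r` lies in `k₀`: compare the `i₀`-th coordinates of `y = r • 1` and `1`
    have hyr : b.repr (y : Matrix (Fin n) (Fin n) k) i₀ =
        r * b.repr (1 : Matrix (Fin n) (Fin n) k) i₀ := by
      rw [← hr, Matrix.scalar_apply, ← Matrix.smul_one_eq_diagonal, map_smul, Finsupp.smul_apply,
        smul_eq_mul]
    obtain ⟨u₀, hu₀⟩ := hmem _ S.one_mem i₀
    obtain ⟨w₀, hw₀⟩ := hmem _ y.2 i₀
    have hrc : r = algebraMap k₀ k (w₀ * u₀⁻¹) := by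
      rw [map_mul, map_inv₀, hu₀, hw₀, hyr, mul_inv_cancel_right₀ hi₀]
    have hyc : y = algebraMap k₀ S (w₀ * u₀⁻¹) := by
      apply Subtype.ext
      rw [Subalgebra.coe_algebraMap, ← hr, hrc]
      rfl
    refine ⟨w₀ * u₀⁻¹, ?_⟩
    have h1 : zd = algebraMap k₀ (Matrix (Fin m) (Fin m) D) (w₀ * u₀⁻¹) := by
      rw [← e.commutes, ← hyc, hydef, e.apply_symm_apply]
    haveI := hm
    have h2 := congrFun (congrFun h1 0) 0
    rw [Matrix.algebraMap_matrix_apply, if_pos rfl] at h2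
    rw [← h2]
    simp [zd]
  -- ### `D = k₀` and `m = n`
  have hbij : Function.Bijective (Algebra.ofId k₀ D) := ⟨(algebraMap k₀ D).injective, hsurj⟩
  let eD : D ≃ₐ[k₀] k₀ := (AlgEquiv.ofBijective (Algebra.ofId k₀ D) hbij).symm
  let e' : S ≃ₐ[k₀] Matrix (Fin m) (Fin m) k₀ := e.trans eD.mapMatrix
  have hmn : m = n := by
    have h := e'.toLinearEquiv.finrank_eq
    rw [hfinS, hcardι, Module.finrank_matrix, Module.finrank_self, Fintype.card_fin, mul_one] at h
    exact Nat.mul_self_inj.mp h.symm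
  subst hmn
  exact ⟨e'⟩

end FiniteField

end Literature.RepresentationTheory.Semisimple
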